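import Summits.ResolutionOfSingularities.ResolutionOfSingularities.Theorems.FrobeniusLadderFInjectiveMacaulayficationExitTagSemantics
import Summits.ResolutionOfSingularities.ResolutionOfSingularities.Theorems.FrobeniusLadderFInjectiveMacaulayficationOmegaOneS2KNewtonKFan
import Summits.ResolutionOfSingularities.ResolutionOfSingularities.Theorems.FrobeniusLadderFInjectiveMacaulayficationB9NewtonKFan
import Summits.ResolutionOfSingularities.ResolutionOfSingularities.Theorems.FrobeniusLadderFInjectiveMacaulayficationSubconeOrder
import Summits.ResolutionOfSingularities.ResolutionOfSingularities.Theorems.FrobeniusLadderFInjectiveMacaulayficationFanCheckSoundBinders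
import Summits.ResolutionOfSingularities.ResolutionOfSingularities.Theorems.FrobeniusLadderFInjectiveMacaulayficationToricChartFedder
import Summits.ResolutionOfSingularities.ResolutionOfSingularities.Theorems.FrobeniusLadderFInjectiveMacaulayficationNewtonChartLemma
import HarnessLib

/-!
# Ω₁ GLOBAL PATCH, per-cone DATA of the refined class model `X̃₂ = Bl_{K″} X_{B9}` on the 1223 charts of Σ₂: the class-centre order `C = V·m_L(parent)` (sub-cone certificate), the pencil exponents
# `A = V·P`, `B = V·Q`, the strict transform `g_c = Σ_j Y^{a_j}`, torus-orbit positivity, and the semantics of tag `9`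
# (BED Ω₁ GLOBAL PATCH, F6 v2 (C)/(D); crux `FInjectiveMacaulayfication` stmt-ResolutionOfSingularities-15315, chain w45a; seat res-L1-w45a-stub-3 g15)

[OURS · L1 W4.5a] Support file (`--supports stmt-ResolutionOfSingularities-15315 --as helper`); theorems only; `decide +kernel` certificates over the in-tree tables + bookkeeping; no named
fact; NOT a statement of any manuscript; nothing of the crux is proved. AI-written (AI review is weaker than expert review).
* §1 certificates: `parent_lt`, `parent_Vq` (the 25 parent cones of Σ(B9) read in `RAYS_S2` are ✓ `B9NewtonKFan.Vq`), `subcone_fac` (`V_c = COEF_S2[c] · V_parent`), `cws_eq` (`CWS_S2 = m_L` of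
  ✓ `B9NewtonKFan.chartM`), `tag9_semB` / `tag9_sem` (on a tag-9 orbit every non-vertex monomial of `f_B9` has a row weight different from — hence strictly above — the vertex's at an orbit letter).
* §2 ★ `hgeB` — on every chart of Σ₂ the class centre `L = (x^e : e ∈ genSet AL2)` attains its order at `m_L(parent c)` (✓ `SubconeOrder.hge_of_subcone` + ✓ `B9NewtonKFan.hge`);
  `coe_chartM_parent`; `dotL_rows_eq` (the F5 list dictionary `⟨row_i, w⟩ = (V_c · w)_i`); ★ `hpos_of_order_pos` (an orbit letter carrying `L`-order lies over the origin: every column of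
  `V_c` is positive on the orbit).
* §3 `aeval_X_pow`, ★ `strictTransform_eq_sum` (`g_c = Σ_j Y^{V_c·(n_j e_j) − V_c·u₀}`), `aeval_g_eq` (`θ_V(x u² − y³) = Y^G·Y^{M₂}(Y^r − Y^s)` from the exponent bookkeeping),
  ★ `eval_strictTransform_ne_zero_of_tag9` (a `k`-point on a tag-9 orbit is not on `V(g_c)`).
[cite: CoxLittleSchenck2011, §2.3, §11.1; IshiiSingularities2018, proof of Lemma 4.4.24]
-/

set_option linter.dupNamespace false
set_option linter.style.longLine false

noncomputable section

namespace Summit.ResolutionOfSingularities.ResolutionOfSingularities.Theorems.FInjectiveMacaulayfication.OmegaOneS2ChartData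

open MvPolynomial
open Summit.ResolutionOfSingularities.ResolutionOfSingularities.Theorems.FInjectiveMacaulayfication
open FanCheckKit FanCheckSound OmegaOneCureFanCert OmegaOneGlobalCureFanCert OmegaOneS2KNewtonKFan

/-! ## §1 Certificates -/

set_option maxRecDepth 100000 in
/-- Parents are among the 25 cones of Σ(B9); the class-centre weights have length 5. [certificate] -/
theorem parent_lt : ∀ c : Fin 1223, getL PARENT_S2 c 0 < 25 ∧ (getL CWS_S2 (getL PARENT_S2 c 0) []).length = 5 := by
  decide +kernel

/-- The parent cone matrices read in `RAYS_S2`/`CONES_B9IDX` ARE ✓ `B9NewtonKFan.Vq`. [certificate] -/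
theorem parent_Vq : ∀ q : Fin 25, ∀ i j : Fin 5, B9NewtonKFan.Vq q i j = vecOf 5 (getL RAYS_S2 (getL (getL CONES_B9IDX q []) i 0) []) j := by
  decide +kernel

set_option maxRecDepth 100000 in
/-- ★ Sub-cone factorisation `V_c = COEF_S2[c] · V_{parent c}` (entrywise). [certificate] -/
theorem subcone_fac : ∀ c : Fin 1223, ∀ i j : Fin 5, Vq c i j =
    getL (getL (getL COEF_S2 c []) i []) 0 0 * vecOf 5 (getL RAYS_S2 (getL (getL CONES_B9IDX (getL PARENT_S2 c 0) []) 0 0) []) j +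
    getL (getL (getL COEF_S2 c []) i []) 1 0 * vecOf 5 (getL RAYS_S2 (getL (getL CONES_B9IDX (getL PARENT_S2 c 0) []) 1 0) []) j +
    getL (getL (getL COEF_S2 c []) i []) 2 0 * vecOf 5 (getL RAYS_S2 (getL (getL CONES_B9IDX (getL PARENT_S2 c 0) []) 2 0) []) j +
    getL (getL (getL COEF_S2 c []) i []) 3 0 * vecOf 5 (getL RAYS_S2 (getL (getL CONES_B9IDX (getL PARENT_S2 c 0) []) 3 0) []) j +
    getL (getL (getL COEF_S2 c []) i []) 4 0 * vecOf 5 (getL RAYS_S2 (getL (getL CONES_B9IDX (getL PARENT_S2 c 0) []) 4 0) []) j := by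
  decide +kernel

set_option maxRecDepth 100000 in
/-- The weights `CWS_S2` are the class-centre vertices `m_L(parent c)` of ✓ `B9NewtonKFan`. [certificate] -/
theorem cws_eq : ∀ c : Fin 1223, getL CWS_S2 (getL PARENT_S2 c 0) [] = get2 B9NewtonKFan.AL2 (chartRec B9NewtonKFan.CL (getL PARENT_S2 c 0)).2.1 := by
  decide +kernel

set_option maxRecDepth 100000 in
/-- ★ **Semantics of tag 9, Boolean form** (one linear pass per cone): on a tag-9 orbit, every support monomial of `f_B9` other than the chart's minimiser has a row weight different from
the minimiser's at some orbit letter. [certificate] -/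
theorem tag9_semB : ∀ c : Fin 1223, (((getL TAGS_S2 c []).zip ORB5).all fun tz =>
    !(Nat.beq tz.1 9) || SUPPv.all fun u => decide (u = U0 c) || (List.finRange 5).any fun i => decide ((i : ℕ) ∈ tz.2) &&
      !(Nat.beq (Vq c i 0 * u 0 + Vq c i 1 * u 1 + Vq c i 2 * u 2 + Vq c i 3 * u 3 + Vq c i 4 * u 4)
        (Vq c i 0 * U0 c 0 + Vq c i 1 * U0 c 1 + Vq c i 2 * U0 c 2 + Vq c i 3 * U0 c 3 + Vq c i 4 * U0 c 4))) = true := by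
  decide +kernel

/-- ★ **Semantics of tag 9**: on a tag-9 orbit, every support monomial of `f_B9` other than the chart's minimiser has a row weight strictly above the minimiser's at some orbit letter. [certificate, unpacked] -/
theorem tag9_sem (c : Fin 1223) (zi : Fin 31) (ht : getL (getL TAGS_S2 c []) zi 9 = 9) (u : Fin 5 → ℕ) (hu : u ∈ SUPPv) (hne : u ≠ U0 c) :
    ∃ i : Fin 5, (i : ℕ) ∈ getL ORB5 zi [] ∧
      Vq c i 0 * u 0 + Vq c i 1 * u 1 + Vq c i 2 * u 2 + Vq c i 3 * u 3 + Vq c i 4 * u 4 ≠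
        Vq c i 0 * U0 c 0 + Vq c i 1 * U0 c 1 + Vq c i 2 * U0 c 2 + Vq c i 3 * U0 c 3 + Vq c i 4 * U0 c 4 := by
  have h := tag9_semB c
  obtain ⟨_, _, _, _, _, _, _, _, _, hTl, hT31, _, hO⟩ := ExitTagSemantics.shapes_S2
  have htlen : (getL TAGS_S2 c []).length = 31 := ExitTagSemantics.length_of_allLen hT31 _ (getL_mem _ _ _ (by rw [hTl]; exact c.2))
  have hmem : (getL (getL TAGS_S2 c []) zi 9, getL ORB5 zi []) ∈ (getL TAGS_S2 c []).zip ORB5 :=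
    mk_getL_mem_zip (getL TAGS_S2 c []) ORB5 9 [] zi (by rw [htlen]; exact zi.2) (by rw [hO]; exact zi.2)
  rw [List.all_eq_true] at h
  have h1 := h _ hmem
  rw [ht] at h1
  simp only [List.all_eq_true, Bool.or_eq_true, Bool.not_eq_true', decide_eq_true_eq, List.any_eq_true, List.mem_finRange, true_and, Bool.and_eq_true] at h1
  have h1' := h1.resolve_left (by decide)
  rcases h1' u hu with h2 | ⟨i, hi, h3⟩
  · exact absurd h2 hne
  · exact ⟨i, hi, Nat.ne_of_beq_eq_false h3⟩

/-! ## §2 The class-centre order on the charts of Σ₂ -/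

/-- The parent cone index as an element of `Fin 25`. -/
theorem parent_fin_val (c : Fin 1223) : ((⟨getL PARENT_S2 c 0, (parent_lt c).1⟩ : Fin 25) : ℕ) = getL PARENT_S2 c 0 := rfl

/-- ★ **`L` ATTAINS ITS ORDER AT `m_L(parent c)` ON EVERY CHART OF Σ₂.** [OURS · bookkeeping; cite: CoxLittleSchenck2011, §11.1 (refinement)] -/
theorem hgeB (c : Fin 1223) : ∀ e ∈ genSet 5 B9NewtonKFan.AL2,
    (Finsupp.equivFunOnFinite.symm ((Vq c).mulVec ⇑(chartM 5 B9NewtonKFan.AL2 B9NewtonKFan.CL 25 ⟨getL PARENT_S2 c 0, (parent_lt c).1⟩)) : Fin 5 →₀ ℕ) ≤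
      Finsupp.equivFunOnFinite.symm ((Vq c).mulVec ⇑e) := by
  set q : Fin 25 := ⟨getL PARENT_S2 c 0, (parent_lt c).1⟩ with hq
  set N : Matrix (Fin 5) (Fin 5) ℕ := Matrix.of fun i l => getL (getL (getL COEF_S2 c []) i []) l 0 with hN
  have hfac : Vq c = N * B9NewtonKFan.Vq q := by
    ext i j
    rw [Matrix.mul_apply, Fin.sum_univ_five]
    simp only [hN, Matrix.of_apply, parent_Vq q]
    exact subcone_fac c i j
  exact SubconeOrder.hge_of_subcone (Vq c) (B9NewtonKFan.Vq q) N hfac _ _ (B9NewtonKFan.hge q)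

/-- The vertex `m_L(parent c)` read as a list is `CWS_S2[parent c]`. [bookkeeping] -/
theorem coe_chartM_parent (c : Fin 1223) :
    ⇑(chartM 5 B9NewtonKFan.AL2 B9NewtonKFan.CL 25 ⟨getL PARENT_S2 c 0, (parent_lt c).1⟩) = vecOf 5 (getL CWS_S2 (getL PARENT_S2 c 0) []) := by
  rw [chartM, coe_expOf]
  exact congrArg (vecOf 5) (cws_eq c).symm

/-- The cone record of `c` in the F5 tables is the ray list of the K″-chart `c`. [bookkeeping] -/
theorem cones_S2_eq (c : Fin 1223) : getL CONES_S2 c [] = (chartRec CL c).1 := by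
  rw [ExitTagSemantics.tables_agree.2, getL_map_of_apply_default (fun x : List ℕ × (ℕ × ℕ) × List (ℕ × ℕ) × List (List ℕ) => x.1) ([], (0, 0), [], []) [] rfl]
  rfl

/-- ★ **The F5 list dictionary**: `⟨row_i(c), w⟩ = (V_c · w)_i` for a weight list `w` of length 5. [bookkeeping] -/
theorem dotL_rows_eq (c : Fin 1223) (w : List ℕ) (hw : w.length = 5) (i : Fin 5) :
    dotL (getL (raysOf RAYS_S2 (getL CONES_S2 c [])) i []) w = (Vq c).mulVec (vecOf 5 w) i := by
  have hsh := shapes.1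
  have hch := shapes_chart (n := 5) (r := 0) (AL2 := AL2) (RAYS := RAYS) (CL := CL) hsh (chartRec_mem tlen c)
  rw [cones_S2_eq, ExitTagSemantics.tables_agree.1, getL_raysOf _ _ _ (by rw [hch.1]; exact i.2), hVq c, chartV,
    mulVec_rayMat RAYS _ w hw (shapes_RAYS hsh) hch.2.1 i (by rw [hch.1]; exact i.2)]

/-- ★ **An orbit letter carrying `L`-order lies over the origin**: if `(V_c · m_L)_{i₀} > 0` then every column of `V_c` is positive at `i₀`, so `Σ_{i ∈ Z} V_c i j > 0` whenever `i₀ ∈ Z`.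
(Pure powers `x_j^N ∈ L`.) [bookkeeping] -/
theorem hpos_of_order_pos (c : Fin 1223) (Z : Finset (Fin 5)) (i₀ : Fin 5) (hi₀ : i₀ ∈ Z)
    (hC : 0 < (Vq c).mulVec (vecOf 5 (getL CWS_S2 (getL PARENT_S2 c 0) [])) i₀) : ∀ j : Fin 5, 0 < ∑ i ∈ Z, Vq c i j := by
  intro j
  obtain ⟨N, hN⟩ := B9NewtonKFan.hprimAJ.2.1 j (Finset.mem_univ j)
  have h := hgeB c _ hN i₀
  simp only [Finsupp.coe_equivFunOnFinite_symm, coe_chartM_parent] at h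
  have hsingle : (Vq c).mulVec ⇑(Finsupp.single j N) i₀ = Vq c i₀ j * N := by
    rw [Matrix.mulVec, dotProduct, Finset.sum_eq_single j]
    · rw [Finsupp.single_eq_same]
    · intro l _ hl; rw [Finsupp.single_eq_of_ne hl, mul_zero]
    · intro h; exact absurd (Finset.mem_univ j) h
  rw [hsingle] at h
  have hpos : 0 < Vq c i₀ j := by
    rcases Nat.eq_zero_or_pos (Vq c i₀ j) with h0 | h0
    · rw [h0, zero_mul] at h; omega
    · exact h0
  exact lt_of_lt_of_le hpos (Finset.single_le_sum (f := fun i => Vq c i j) (fun i _ => Nat.zero_le _) hi₀)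

/-! ## §3 The strict transform and the pencil on a chart -/

/-- `θ_V (X_j^N) = Y^{N · (column j of V)}`. [certificate] -/
theorem aeval_X_pow {k : Type} [Field k] (V : Matrix (Fin 5) (Fin 5) ℕ) (j : Fin 5) (N : ℕ) :
    aeval (fun j : Fin 5 => ∏ i : Fin 5, (X i : MvPolynomial (Fin 5) k) ^ V i j) (X j ^ N : MvPolynomial (Fin 5) k) = monomial (Finsupp.equivFunOnFinite.symm fun i => V i j * N) 1 := by
  rw [show (X j ^ N : MvPolynomial (Fin 5) k) = monomial (Finsupp.single j N) 1 by rw [X_pow_eq_monomial],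
    NewtonChartLemma.aeval_monomial_eq V (Finsupp.single j N) 1 _ (fun i => ?_)]
  rw [Finsupp.coe_equivFunOnFinite_symm, Finset.sum_eq_single j]
  · rw [Finsupp.single_eq_same]
  · intro l _ hl; rw [Finsupp.single_eq_of_ne hl, mul_zero]
  · intro h; exact absurd (Finset.mem_univ j) h

/-- `Σ_l V_c i l · (N e_j)_l = V_c i j · N`. [plumbing] -/
theorem sum_mul_single (c : Fin 1223) (i j : Fin 5) (N : ℕ) : ∑ l, Vq c i l * (Finsupp.single j N) l = Vq c i j * N := by
  rw [Finset.sum_eq_single j]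
  · rw [Finsupp.single_eq_same]
  · intro l _ hl; rw [Finsupp.single_eq_of_ne hl, mul_zero]
  · intro h0; exact absurd (Finset.mem_univ j) h0

/-- The row weights of the chart minimiser are below those of every pure power `x_j^{n_j}` of `f_B9`. [certificate] -/
theorem d_le (k : Type) [Field k] (c : Fin 1223) (i j : Fin 5) :
    ∑ l, Vq c i l * U0 c l ≤ Vq c i j * (![9, 9, 9, 9, 2] : Fin 5 → ℕ) j := by
  have hf : (X 4 ^ 2 + X 0 ^ 9 + X 1 ^ 9 + X 2 ^ 9 + X 3 ^ 9 : MvPolynomial (Fin 5) k) = X 4 ^ 2 + X 0 ^ 9 + X 1 ^ 9 + X 2 ^ 9 + X 3 ^ 9 := rfl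
  obtain ⟨s4, s0, s1, s2, s3⟩ := B9NewtonKFan.single_mem_support k _ hf
  have h := hmin k _ hf c i
  simp only [coe_u0] at h
  have key : ∀ (N : ℕ), Finsupp.single j N ∈ (X 4 ^ 2 + X 0 ^ 9 + X 1 ^ 9 + X 2 ^ 9 + X 3 ^ 9 : MvPolynomial (Fin 5) k).support →
      ∑ l, Vq c i l * U0 c l ≤ Vq c i j * N := fun N hN => by
    have h' := h _ hN
    rwa [sum_mul_single c i j N] at h'
  fin_cases j
  · exact key 9 s0
  · exact key 9 s1
  · exact key 9 s2
  · exact key 9 s3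
  · exact key 2 s4

/-- ★ **THE STRICT TRANSFORM ON CHART `c`, EXPANDED**: `g_c = Σ_j Y^{a_j}` with `a_j = n_j · (column j of V_c) − V_c·u₀`, `n = (9,9,9,9,2)`. [certificate; cite: IshiiSingularities2018, proof of Lemma 4.4.24] -/
theorem strictTransform_eq_sum (k : Type) [Field k] (c : Fin 1223) (g : MvPolynomial (Fin 5) k)
    (hθ : aeval (fun j : Fin 5 => ∏ i : Fin 5, (X i : MvPolynomial (Fin 5) k) ^ Vq c i j) (X 4 ^ 2 + X 0 ^ 9 + X 1 ^ 9 + X 2 ^ 9 + X 3 ^ 9 : MvPolynomial (Fin 5) k) =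
      monomial (Finsupp.equivFunOnFinite.symm ((Vq c).mulVec (U0 c))) 1 * g) :
    g = ∑ j : Fin 5, monomial (Finsupp.equivFunOnFinite.symm fun i => Vq c i j * (![9, 9, 9, 9, 2] : Fin 5 → ℕ) j - ∑ l, Vq c i l * U0 c l) (1 : k) := by
  have hne : (monomial (Finsupp.equivFunOnFinite.symm ((Vq c).mulVec (U0 c))) (1 : k) : MvPolynomial (Fin 5) k) ≠ 0 := monomial_eq_zero.not.mpr one_ne_zero
  refine mul_left_cancel₀ hne ?_
  rw [← hθ, Finset.mul_sum]
  have hf : (X 4 ^ 2 + X 0 ^ 9 + X 1 ^ 9 + X 2 ^ 9 + X 3 ^ 9 : MvPolynomial (Fin 5) k) = ∑ j : Fin 5, X j ^ (![9, 9, 9, 9, 2] : Fin 5 → ℕ) j := by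
    rw [Fin.sum_univ_five]; simp only [Matrix.cons_val_zero, Matrix.cons_val_one, Matrix.cons_val]; ring
  rw [hf, map_sum]
  refine Finset.sum_congr rfl fun j _ => ?_
  rw [aeval_X_pow, monomial_mul, one_mul]
  have hexp : (Finsupp.equivFunOnFinite.symm fun i => Vq c i j * (![9, 9, 9, 9, 2] : Fin 5 → ℕ) j : Fin 5 →₀ ℕ) =
      Finsupp.equivFunOnFinite.symm ((Vq c).mulVec (U0 c)) + Finsupp.equivFunOnFinite.symm (fun i => Vq c i j * (![9, 9, 9, 9, 2] : Fin 5 → ℕ) j - ∑ l, Vq c i l * U0 c l) := by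
    ext i
    rw [Finsupp.add_apply]
    simp only [Finsupp.coe_equivFunOnFinite_symm, Matrix.mulVec, dotProduct]
    have := d_le k c i j
    omega
  rw [hexp]

/-- `θ_V (x u² − y³) = Y^{V·P} − Y^{V·Q}` with `P = (1,0,2,0,0)`, `Q = (0,3,0,0,0)`. [certificate] -/
theorem aeval_g0_eq {k : Type} [Field k] (V : Matrix (Fin 5) (Fin 5) ℕ) :
    aeval (fun j : Fin 5 => ∏ i : Fin 5, (X i : MvPolynomial (Fin 5) k) ^ V i j) (X 0 * X 2 ^ 2 - X 1 ^ 3 : MvPolynomial (Fin 5) k) =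
      monomial (Finsupp.equivFunOnFinite.symm (V.mulVec (vecOf 5 [1, 0, 2, 0, 0]))) 1 - monomial (Finsupp.equivFunOnFinite.symm (V.mulVec (vecOf 5 [0, 3, 0, 0, 0]))) 1 := by
  have hP : (X 0 * X 2 ^ 2 : MvPolynomial (Fin 5) k) = monomial (Finsupp.equivFunOnFinite.symm (vecOf 5 [1, 0, 2, 0, 0])) 1 := by
    have : (Finsupp.equivFunOnFinite.symm (vecOf 5 [1, 0, 2, 0, 0]) : Fin 5 →₀ ℕ) = Finsupp.single 0 1 + Finsupp.single 2 2 := by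
      ext i; fin_cases i <;> simp [vecOf, getL]
    rw [this, show (1 : k) = 1 * 1 from (mul_one 1).symm, ← monomial_mul, ← X_pow_eq_monomial, ← X_pow_eq_monomial, pow_one]
  have hQ : (X 1 ^ 3 : MvPolynomial (Fin 5) k) = monomial (Finsupp.equivFunOnFinite.symm (vecOf 5 [0, 3, 0, 0, 0])) 1 := by
    have : (Finsupp.equivFunOnFinite.symm (vecOf 5 [0, 3, 0, 0, 0]) : Fin 5 →₀ ℕ) = Finsupp.single 1 3 := by
      ext i; fin_cases i <;> simp [vecOf, getL]
    rw [this, X_pow_eq_monomial]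
  rw [map_sub, hP, hQ, ToricChartFedder.theta_monomial, ToricChartFedder.theta_monomial]
  simp only [Finsupp.coe_equivFunOnFinite_symm]

/-- ★ **The pencil on the chart**: with `m = min(A, B)`, `G = min(C, m)`, `M₂ = m − G`, `r = A − m`, `s = B − m`: `Y^A − Y^B = Y^G · (Y^{M₂} · (Y^r − Y^s))`. [bookkeeping] -/
theorem binomial_eq_of_exponents {k : Type} [Field k] {n : ℕ} (A B G M₂ r s : Fin n →₀ ℕ) (hA : ∀ i, A i = G i + M₂ i + r i) (hB : ∀ i, B i = G i + M₂ i + s i) :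
    (monomial A (1 : k) : MvPolynomial (Fin n) k) - monomial B 1 = monomial G 1 * (monomial M₂ 1 * (monomial r 1 - monomial s 1)) := by
  have hA' : A = G + M₂ + r := by ext i; simp [hA i]
  have hB' : B = G + M₂ + s := by ext i; simp [hB i]
  rw [hA', hB']
  simp only [mul_sub, monomial_mul, one_mul, add_assoc]

/-- ★ **A `k`-point on a tag-9 orbit does not lie on the strict transform**: `g_c(y) = 1·(vertex term) + 0 ≠ 0`. [certificate semantics] -/
theorem eval_strictTransform_ne_zero_of_tag9 {k : Type} [Field k] (c : Fin 1223) (zi : Fin 31) (ht : getL (getL TAGS_S2 c []) zi 9 = 9)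
    (y : Fin 5 → k) (hy : ∀ i : Fin 5, y i = 0 ↔ (i : ℕ) ∈ getL ORB5 zi []) :
    eval y (∑ j : Fin 5, monomial (Finsupp.equivFunOnFinite.symm fun i => Vq c i j * (![9, 9, 9, 9, 2] : Fin 5 → ℕ) j - ∑ l, Vq c i l * U0 c l) (1 : k)) ≠ 0 := by
  classical
  -- the vertex `u₀ = n_{j₀} e_{j₀}`
  have hmem := hU0_mem c
  rw [suppv_eq, B9NewtonKFan.mem_SUPPv_iff] at hmem
  have hsingle : ∀ (j₀ : Fin 5) (N : ℕ), U0 c = ⇑(Finsupp.single j₀ N) → ∀ i, ∑ l, Vq c i l * U0 c l = Vq c i j₀ * N := fun j₀ N h i => by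
    rw [h]; exact sum_mul_single c i j₀ N
  obtain ⟨j₀, hj₀⟩ : ∃ j₀ : Fin 5, U0 c = ⇑(Finsupp.single j₀ ((![9, 9, 9, 9, 2] : Fin 5 → ℕ) j₀)) := by
    rcases hmem with h | h | h | h | h
    · exact ⟨4, h⟩
    · exact ⟨0, h⟩
    · exact ⟨1, h⟩
    · exact ⟨2, h⟩
    · exact ⟨3, h⟩
  have hd := hsingle j₀ _ hj₀
  rw [map_sum, Finset.sum_eq_single j₀]
  · -- the vertex term is `1`
    have h0 : (Finsupp.equivFunOnFinite.symm fun i => Vq c i j₀ * (![9, 9, 9, 9, 2] : Fin 5 → ℕ) j₀ - ∑ l, Vq c i l * U0 c l) = (0 : Fin 5 →₀ ℕ) := by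
      ext i; simp [hd i]
    rw [h0, monomial_zero', C_1, map_one]; exact one_ne_zero
  · -- every other term vanishes at `y`
    intro j _ hj
    have hu : (⇑(Finsupp.single j ((![9, 9, 9, 9, 2] : Fin 5 → ℕ) j)) : Fin 5 → ℕ) ∈ SUPPv := by
      rw [suppv_eq, B9NewtonKFan.mem_SUPPv_iff]
      fin_cases j
      · exact Or.inr (Or.inl rfl)
      · exact Or.inr (Or.inr (Or.inl rfl))
      · exact Or.inr (Or.inr (Or.inr (Or.inl rfl)))
      · exact Or.inr (Or.inr (Or.inr (Or.inr rfl)))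
      · exact Or.inl rfl
    have hne : (⇑(Finsupp.single j ((![9, 9, 9, 9, 2] : Fin 5 → ℕ) j)) : Fin 5 → ℕ) ≠ U0 c := by
      rw [hj₀]; intro h
      have := congr_fun h j
      rw [Finsupp.single_eq_same, Finsupp.single_eq_of_ne hj] at this
      revert this; fin_cases j <;> simp
    obtain ⟨i, hiZ, hlt⟩ := tag9_sem c zi ht _ hu hne
    have hle := d_le k c i j
    have hsj := sum_mul_single c i j ((![9, 9, 9, 9, 2] : Fin 5 → ℕ) j)
    rw [Fin.sum_univ_five] at hle hsj
    rw [hsj] at hlt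
    apply NewtonChartLemma.eval_monomial_eq_zero_of_exists (Finset.univ.filter fun i : Fin 5 => (i : ℕ) ∈ getL ORB5 zi []) y
      (fun i => by rw [Finset.mem_filter]; simp [hy i])
    refine ⟨i, Finset.mem_filter.mpr ⟨Finset.mem_univ i, hiZ⟩, ?_⟩
    simp only [Finsupp.coe_equivFunOnFinite_symm, Fin.sum_univ_five]
    omega
  · intro h; exact absurd (Finset.mem_univ j₀) h

end Summit.ResolutionOfSingularities.ResolutionOfSingularities.Theorems.FInjectiveMacaulayfication.OmegaOneS2ChartData

end
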